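import Literature.Probability.LatticeModels.ProdBernoulliIndependence
import HarnessLib

/-!
# QUANT lane R8: the forest axioms of `Quant.FarTreeRow` cannot be dropped — the far-relay row FAILS for AND-events
# over a non-nested family of gate sets (the triangle hypergraph), at layer `j = 1`, all gates `9/10`

builds on p205010 (kernel theorem, internal audit signed; external expert review pending)

Support file (`--supports stmt-CriticalPhenomena-4575`), QUANT lane seat prim-quant-p1 (gen 7); memo
`run/shared/lean/prim/quant/P1-SURPLUS.md` §18.  Theorems only; no definitions, no named facts, no sorries, no certificates
(`decide` only on `Fin 3` bookkeeping); standard axioms.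

`Quant.FarTreeRow` (`…QuantFarTreeRow.lean`, OPEN for branching trees, proved on spiders / combs / block-stars / layer one) reads, in gate
coordinates: independent gates `q` on `Fin m`, relay `a` reached iff its gate set `P a` is open, `T a = ∏_{y ∈ P a} q y`; under the three
FOREST AXIOMS (`x ∈ P x`; `y ∈ P x → P y ⊆ P x`; members of `P x` pairwise comparable) the row `2j < Σ_{a∈A} T a ∧ (∀ a, 1 − T a ≤ t) ⟹
P(#{a ∈ A | P a open} ≤ j) ≤ t` is conjectured.  Every reach event is then an increasing AND-event and the family `(P a)` is LAMINAR.
Two natural weakenings suggest themselves (P1-SURPLUS §17.10 recorded 0 violations for both in the pendant form (SMS-PA), 4 341 + 4 658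
sampled instances): keep the AND-form but allow ARBITRARY gate sets (a hypergraph), or allow arbitrary increasing events.  Both are FALSE,
already at `j = 1` with three relays:

* `Quant.farRow_gateSets_needs_nesting` — **the row fails for the triangle hypergraph** `P 0 = {0,1}`, `P 1 = {1,2}`, `P 2 = {0,2}` on three
  gates of probability `9/10` (reflexive: `a ∈ P a`; not down-closed): `Σ_a T a = 3·(81/100) = 243/100 > 2`, `1 − T a = 19/100 =: t`, but at most one
  pair is open unless all three gates are, so `P(N ≤ 1) = 1 − 729/1000 = 271/1000 > t`.  In the shape of `Quant.FarTreeRow` with the two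
  nesting axioms deleted (reflexivity kept).  Hence ANY proof of the tree row must use the nested structure of the ancestor sets, not merely
  that reach events are conjunctions of independent gates (Harris/positive association is necessary — LEAD-NOTES-G6 N14 — but not sufficient).
* (memo only, same mechanism for OR-events) `E_b = {g₀ open} ∪ {g_b open}`, `b = 1,2,3`, `q g₀ = 3/5`, `q g_b = 1/4`: `Σ P(E_b) = 21/10 > 2`,
  `min P(E_b) = 7/10`, `P(N ≥ 2) = 53/80 < 7/10` — increasing DNF events fail too; for graphs (`Quant.FarRelayRow`) reach events are DNFs
  over paths, so the conjectured graph row rests on the transitivity of connection, not on monotonicity alone.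
[cite: KozmaNitzan2024, Conjecture 3 (p. 15)] (the gluing rows `Quant.FarTreeRow` serves); the witnesses are [this work].
-/

noncomputable section

namespace Summit.CriticalPhenomena.PercolationContinuityZ3.Theorems

namespace Quant

open Finset MeasureTheory
open Literature.Probability.LatticeModels
open scoped Classical

/-- Bookkeeping on `Fin 3` for the triangle hypergraph `P a = univ.erase (a + 2)` (`P 0 = {0,1}`, `P 1 = {1,2}`, `P 2 = {0,2}`):
a gate `i` lies in every `P a` except `P (i + 1)`. [this work] -/
theorem triangle_mem_erase (i a : Fin 3) (ha : a ≠ i + 1) : i ∈ (Finset.univ : Finset (Fin 3)).erase (a + 2) := by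
  revert i a
  decide

/-- For the triangle hypergraph, if some gate `i` is closed then at most the relay `i + 1` is reached:
the reached relays form a subset of `{i + 1}`. [this work] -/
theorem triangle_filter_subset_singleton (ω : Set (Fin 3)) (i : Fin 3) (hi : i ∉ ω) :
    ((Finset.univ : Finset (Fin 3)).filter fun a =>
        (((Finset.univ : Finset (Fin 3)).erase (a + 2) : Finset (Fin 3)) : Set (Fin 3)) ⊆ ω) ⊆ {i + 1} := by
  intro a ha
  rw [Finset.mem_filter] at ha
  rw [Finset.mem_singleton]
  by_contra hne
  exact hi (ha.2 (Finset.mem_coe.2 (triangle_mem_erase i a hne)))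

/-- The light event of the triangle hypergraph at layer `1` is the complement of "all three gates open". [this work] -/
theorem triangle_light_eq_compl :
    {ω : Set (Fin 3) | ((Finset.univ : Finset (Fin 3)).filter fun a =>
        (((Finset.univ : Finset (Fin 3)).erase (a + 2) : Finset (Fin 3)) : Set (Fin 3)) ⊆ ω).card ≤ 1} =
      {ω : Set (Fin 3) | ((Finset.univ : Finset (Fin 3)) : Set (Fin 3)) ⊆ ω}ᶜ := by
  ext ω
  simp only [Set.mem_setOf_eq, Set.mem_compl_iff]
  constructor
  · -- if all gates are open, all three relays are reached
    intro hcard hall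
    have hfull : ((Finset.univ : Finset (Fin 3)).filter fun a =>
        (((Finset.univ : Finset (Fin 3)).erase (a + 2) : Finset (Fin 3)) : Set (Fin 3)) ⊆ ω) = Finset.univ := by
      refine Finset.filter_true_of_mem fun a _ => ?_
      exact subset_trans (Finset.coe_subset.2 (Finset.erase_subset _ _)) hall
    rw [hfull, Finset.card_univ, Fintype.card_fin] at hcard
    omega
  · -- if some gate `i` is closed, only the relay `i + 1` can be reached
    intro hnot
    obtain ⟨i, -, hi⟩ := Set.not_subset.1 hnot
    exact le_trans (Finset.card_le_card (triangle_filter_subset_singleton ω i hi)) (by simp)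

/-- **The nesting axioms of `Quant.FarTreeRow` cannot be dropped.**  It is NOT true that for every `m`, every REFLEXIVE family of gate sets
`P : Fin m → Finset (Fin m)` (`x ∈ P x`), all gates `q`, relay sets `A`, layers `j` and `t`, the hypotheses `2j < Σ_{a∈A} ∏_{y∈P a} q y` and
`1 − ∏_{y ∈ P a} q y ≤ t` (`a ∈ A`) imply `P(#{a ∈ A | ↑(P a) ⊆ ω} ≤ j) ≤ t` under `prodBernoulli q`: the triangle hypergraph
`P a = univ.erase (a+2)` on `Fin 3` with all gates `9/10`, `A = univ`, `j = 1`, `t = 19/100` has `Σ = 243/100 > 2` but `P(N ≤ 1) = 271/1000 > 19/100`.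
builds on p205010 (kernel theorem, internal audit signed; external expert review pending). [this work] -/
theorem farRow_gateSets_needs_nesting :
    ¬ ∀ (m : ℕ) (P : Fin m → Finset (Fin m)),
      (∀ x, x ∈ P x) →
      ∀ (q : Fin m → unitInterval) (A : Finset (Fin m)) (j : ℕ) (t : ℝ),
        (2 * j : ℝ) < ∑ a ∈ A, ∏ y ∈ P a, (q y : ℝ) →
        (∀ a ∈ A, 1 - ∏ y ∈ P a, (q y : ℝ) ≤ t) →
        (prodBernoulli q).real
          {ω : Set (Fin m) | (A.filter fun a => ((P a : Finset (Fin m)) : Set (Fin m)) ⊆ ω).card ≤ j} ≤ t := by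
  intro h
  set q₀ : unitInterval := ⟨(9 : ℝ) / 10, by constructor <;> norm_num⟩ with hq₀
  have hq₀val : ((q₀ : unitInterval) : ℝ) = 9 / 10 := by rw [hq₀]
  set P : Fin 3 → Finset (Fin 3) := fun a => (Finset.univ : Finset (Fin 3)).erase (a + 2) with hP
  have hrefl : ∀ x : Fin 3, x ∈ P x := by
    intro x
    simp only [hP]
    revert x
    decide
  -- every gate set has two elements, so every marginal is `(9/10)^2`
  have hcardP : ∀ a : Fin 3, (P a).card = 2 := by
    intro a
    simp only [hP]
    rw [Finset.card_erase_of_mem (Finset.mem_univ _), Finset.card_univ, Fintype.card_fin]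
  have hprod : ∀ a : Fin 3, ∏ y ∈ P a, (((fun _ : Fin 3 => q₀) y : unitInterval) : ℝ) = 81 / 100 := by
    intro a
    rw [Finset.prod_const, hcardP a, hq₀val]
    norm_num
  have hEN : (2 * (1 : ℕ) : ℝ) < ∑ a ∈ (Finset.univ : Finset (Fin 3)), ∏ y ∈ P a, (((fun _ : Fin 3 => q₀) y : unitInterval) : ℝ) := by
    rw [Finset.sum_congr rfl fun a _ => hprod a, Finset.sum_const, Finset.card_univ, Fintype.card_fin]
    norm_num
  have ht : ∀ a ∈ (Finset.univ : Finset (Fin 3)), 1 - ∏ y ∈ P a, (((fun _ : Fin 3 => q₀) y : unitInterval) : ℝ) ≤ 19 / 100 := by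
    intro a _
    rw [hprod a]
    norm_num
  have hrow := h 3 P hrefl (fun _ => q₀) Finset.univ 1 (19 / 100) hEN ht
  -- the light event is the complement of "all gates open", of probability `1 - (9/10)^3`
  have hlight : (prodBernoulli (fun _ : Fin 3 => q₀)).real
      {ω : Set (Fin 3) | ((Finset.univ : Finset (Fin 3)).filter fun a => ((P a : Finset (Fin 3)) : Set (Fin 3)) ⊆ ω).card ≤ 1} =
        271 / 1000 := by
    have heq := triangle_light_eq_compl
    simp only [hP] at heq ⊢
    rw [heq, probReal_compl_eq_one_sub MeasurableSet.of_discrete, prodBernoulli_real_subset,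
      Finset.prod_const, Finset.card_univ, Fintype.card_fin, hq₀val]
    norm_num
  rw [hlight] at hrow
  norm_num at hrow

end Quant

end Summit.CriticalPhenomena.PercolationContinuityZ3.Theorems

end
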